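import Mathlib
import Summits.MatrixMultiplication.MatrixMultiplication.Theorems.FourierTwoFamiliesModPPrimeCyclicPowerGainThetaCliqueCover

/-!
# The common-side clique: one `A`-side class is wall-bounded (stub `stub_thetaCommonSide`)

Crux `stmt-MatrixMultiplication-14310` (`FourierTwoFamiliesModP.PrimeLogDecay`), line
`fixed-delta-theta-certificate`; closes the registered milestone stub `stub_thetaCommonSide`.

Setting: `G` a finite additive commutative group, a frozen set `X₀ ⊆ G`, a kernel `B` on block pairs
`v = (v.1, v.2) ∈ Finset G × Finset G` that is symmetric, PSD, entrywise nonnegative and supported on admissible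
(`|v.1| = |v.2| = s`, direct, `v.1 − v.2 ⊆ X₀`) equal-or-compatible pairs (the bet's support hypothesis), whose
diagonal support moreover consists of vertices with a COMMON `A`-SIDE SHAPE: `v.1 = x +ᵥ A₀` for some `x : G`.
Then `s² · Σ_{v,w} B v w ≤ |G| · Σ_v B v v` — the single-shape wall `|G|/s²`, now for ARBITRARY `B`-sides.

Proof.  **Common-side clique** (`entry_eq_zero_of_commonSide`): if `v.1 = x +ᵥ A₀`, `c + a ∈ v.2` and
`c + a' ∈ w.2` with `a, a' ∈ A₀`, then `(x + a') − (c + a') = x − c = (x + a) − (c + a) ∈ v.1 − v.2 ⊆ X₀`, so the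
cross-difference set `v.1 − w.2` meets `X₀` and `v, w` are NOT compatible: `B v w = 0` for `v ≠ w`.  Hence for every
`c : G` the support vertices whose `B`-side meets `c +ᵥ A₀` form a clique in the kernel sense, and a support vertex
`v` lies in exactly `|v.2 − A₀| = s²` of them (`filter_meets_vadd_eq_sub`, `card_sub_eq_mul_of_direct`).  The landed
fractional clique-cover bound `CliqueCover.value_le_of_cliqueCover` with the `|G|` cliques, weights `1/s²` and
multiplicity `μ = 1` gives `Σ B ≤ (|G|/s²) · tr B`.
-/

namespace Summit.MatrixMultiplication.MatrixMultiplication.Theorems.PrimeLogDecayTheta.CommonSide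

open Finset
open scoped Pointwise BigOperators
open Summit.MatrixMultiplication.MatrixMultiplication.Theorems.PrimeCyclicPowerGainTheta

/-- **Common-side clique, kernel form.**  Let the nonzero entries of `B` sit on pairs `(v, w)` with
`v.1 − v.2 ⊆ X₀` that are equal or compatible.  If `v.1 = x +ᵥ A₀` and both `v.2` and `w.2` meet the translate
`c +ᵥ A₀`, then `B v w = 0` for `v ≠ w`: with `c + a ∈ v.2`, `c + a' ∈ w.2`,
`(x + a') − (c + a') = (x + a) − (c + a) ∈ (v.1 − v.2) ⊆ X₀` lies in `v.1 − w.2`. -/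
theorem entry_eq_zero_of_commonSide {G : Type*} [AddCommGroup G] [DecidableEq G] (X₀ A₀ : Finset G)
    (B : Finset G × Finset G → Finset G × Finset G → ℝ)
    (hsupp : ∀ v w : Finset G × Finset G, B v w ≠ 0 →
      v.1 - v.2 ⊆ X₀ ∧ (v = w ∨ (Disjoint (v.1 - w.2) X₀ ∧ Disjoint (w.1 - v.2) X₀)))
    (c x : G) (v w : Finset G × Finset G) (hvw : v ≠ w) (hvA : v.1 = x +ᵥ A₀)
    (hv : ((c +ᵥ A₀) ∩ v.2).Nonempty) (hw : ((c +ᵥ A₀) ∩ w.2).Nonempty) : B v w = 0 := by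
  by_contra hB
  obtain ⟨hsub, h⟩ := hsupp v w hB
  rcases h with h | ⟨hdis, _⟩
  · exact hvw h
  · obtain ⟨y, hy⟩ := hv
    obtain ⟨y', hy'⟩ := hw
    rw [Finset.mem_inter, Finset.mem_vadd_finset] at hy hy'
    obtain ⟨⟨a, ha, rfl⟩, hav⟩ := hy
    obtain ⟨⟨a', ha', rfl⟩, haw⟩ := hy'
    have hxa : x +ᵥ a ∈ v.1 := by
      rw [hvA]
      exact (Finset.vadd_mem_vadd_finset_iff x).2 ha
    have hxa' : x +ᵥ a' ∈ v.1 := by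
      rw [hvA]
      exact (Finset.vadd_mem_vadd_finset_iff x).2 ha'
    -- `x - c = (x + a) - (c + a) ∈ v.1 - v.2 ⊆ X₀`
    have hX : x - c ∈ X₀ := by
      have hmem : (x +ᵥ a) - (c +ᵥ a) ∈ v.1 - v.2 := Finset.sub_mem_sub hxa hav
      have e : (x +ᵥ a) - (c +ᵥ a) = x - c := by
        simp only [vadd_eq_add]
        abel
      rw [e] at hmem
      exact hsub hmem
    -- `x - c = (x + a') - (c + a') ∈ v.1 - w.2`
    have hbad : x - c ∈ v.1 - w.2 := by
      have hmem : (x +ᵥ a') - (c +ᵥ a') ∈ v.1 - w.2 := Finset.sub_mem_sub hxa' haw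
      have e : (x +ᵥ a') - (c +ᵥ a') = x - c := by
        simp only [vadd_eq_add]
        abel
      rw [e] at hmem
      exact hmem
    exact Finset.disjoint_left.1 hdis hbad hX

/-- The translates `c +ᵥ A₀` meeting `T` are indexed by `c ∈ T − A₀`. -/
theorem filter_meets_vadd_eq_sub {G : Type*} [AddCommGroup G] [Fintype G] [DecidableEq G]
    (A₀ T : Finset G) :
    (Finset.univ.filter fun c : G => ((c +ᵥ A₀) ∩ T).Nonempty) = T - A₀ := by
  ext c
  simp only [Finset.mem_filter, Finset.mem_univ, true_and, Finset.mem_sub]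
  constructor
  · rintro ⟨y, hy⟩
    rw [Finset.mem_inter, Finset.mem_vadd_finset] at hy
    obtain ⟨⟨a, ha, rfl⟩, hyT⟩ := hy
    exact ⟨c +ᵥ a, hyT, a, ha, by simp only [vadd_eq_add]; abel⟩
  · rintro ⟨b, hb, a, ha, rfl⟩
    refine ⟨b, ?_⟩
    rw [Finset.mem_inter, Finset.mem_vadd_finset]
    exact ⟨⟨a, ha, by simp only [vadd_eq_add]; abel⟩, hb⟩

/-- Directness of `(x +ᵥ A₀, T)` makes `(b, a) ↦ b − a` injective on `T × A₀`: `|T − A₀| = |T| · |A₀|`. -/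
theorem card_sub_eq_mul_of_direct {G : Type*} [AddCommGroup G] [DecidableEq G] (A₀ T : Finset G) (x : G)
    (hW : ∀ a ∈ x +ᵥ A₀, ∀ a' ∈ x +ᵥ A₀, ∀ b ∈ T, ∀ b' ∈ T, (a - a') + (b - b') = 0 → a = a' ∧ b = b') :
    (T - A₀).card = T.card * A₀.card := by
  rw [Finset.sub_def, ← Finset.card_product, Finset.card_image_iff]
  rintro ⟨b, a⟩ hba ⟨b', a'⟩ hba' h
  simp only [Finset.coe_product, Set.mem_prod, Finset.mem_coe] at hba hba'
  simp only at h
  -- `b - a = b' - a'` gives `((x + a') - (x + a)) + (b - b') = 0`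
  have h0 : ((x +ᵥ a') - (x +ᵥ a)) + (b - b') = 0 := by
    have e : ((x +ᵥ a') - (x +ᵥ a)) + (b - b') = (b - a) - (b' - a') := by
      simp only [vadd_eq_add]
      abel
    rw [e, h, sub_self]
  obtain ⟨e1, e2⟩ := hW (x +ᵥ a') ((Finset.vadd_mem_vadd_finset_iff x).2 hba'.2) (x +ᵥ a)
    ((Finset.vadd_mem_vadd_finset_iff x).2 hba.2) b hba.1 b' hba'.1 h0
  have e3 : a' = a := by
    simp only [vadd_eq_add] at e1
    exact add_left_cancel e1
  rw [e2, e3]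

/-- **Common-side bound** (named-hypothesis form of `stub_thetaCommonSide`).  `G` a finite additive commutative
group; `B` a symmetric PSD entrywise-nonnegative kernel on block pairs whose nonzero entries sit on admissible
(`|v.1| = |v.2| = s`, direct, `v.1 − v.2 ⊆ X₀`) equal-or-compatible pairs; every vertex of the diagonal support
has `A`-side a translate of the fixed set `A₀`.  Then `s² · Σ_{v,w} B v w ≤ |G| · Σ_v B v v`. -/
theorem sq_mul_value_le_of_commonSide {G : Type*} [AddCommGroup G] [Fintype G] [DecidableEq G] (s : ℕ)
    (X₀ A₀ : Finset G) (B : Finset G × Finset G → Finset G × Finset G → ℝ)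
    (hsymm : ∀ v w, B v w = B w v)
    (hpsd : ∀ x : Finset G × Finset G → ℝ, 0 ≤ ∑ v, ∑ w, x v * B v w * x w)
    (hnn : ∀ v w, 0 ≤ B v w)
    (hsupp : ∀ v w : Finset G × Finset G, B v w ≠ 0 →
      (v.1.card = s ∧ v.2.card = s ∧
        (∀ a ∈ v.1, ∀ a' ∈ v.1, ∀ b ∈ v.2, ∀ b' ∈ v.2, (a - a') + (b - b') = 0 → a = a' ∧ b = b') ∧
        v.1 - v.2 ⊆ X₀) ∧
      (w.1.card = s ∧ w.2.card = s ∧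
        (∀ a ∈ w.1, ∀ a' ∈ w.1, ∀ b ∈ w.2, ∀ b' ∈ w.2, (a - a') + (b - b') = 0 → a = a' ∧ b = b') ∧
        w.1 - w.2 ⊆ X₀) ∧
      (v = w ∨ (Disjoint (v.1 - w.2) X₀ ∧ Disjoint (w.1 - v.2) X₀)))
    (hA : ∀ v : Finset G × Finset G, B v v ≠ 0 → ∃ x : G, v.1 = x +ᵥ A₀) :
    (s : ℝ) ^ 2 * ∑ v, ∑ w, B v w ≤ (Fintype.card G : ℝ) * ∑ v, B v v := by
  -- diagonal entries are nonnegative, so the case `s = 0` is trivial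
  have htr : 0 ≤ ∑ v, B v v := Finset.sum_nonneg fun v _ => hnn v v
  rcases Nat.eq_zero_or_pos s with hs0 | hspos
  · subst hs0
    simp only [Nat.cast_zero, ne_eq, OfNat.ofNat_ne_zero, not_false_eq_true, zero_pow, zero_mul]
    positivity
  have hsR : (0 : ℝ) < s := Nat.cast_pos.2 hspos
  have hs2 : (0 : ℝ) < (s : ℝ) ^ 2 := by positivity
  -- the common-side cliques: support-shaped vertices whose `B`-side meets `c +ᵥ A₀`
  classical
  set C : G → Finset (Finset G × Finset G) := fun c =>
    Finset.univ.filter fun v : Finset G × Finset G =>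
      ((c +ᵥ A₀) ∩ v.2).Nonempty ∧ (∃ x : G, v.1 = x +ᵥ A₀) with hC
  have hmem : ∀ c v, v ∈ C c ↔ ((c +ᵥ A₀) ∩ v.2).Nonempty ∧ (∃ x : G, v.1 = x +ᵥ A₀) := by
    intro c v
    simp only [hC, Finset.mem_filter, Finset.mem_univ, true_and]
  -- support hypothesis in the short form used by the clique lemma
  have hsupp' : ∀ v w : Finset G × Finset G, B v w ≠ 0 →
      v.1 - v.2 ⊆ X₀ ∧ (v = w ∨ (Disjoint (v.1 - w.2) X₀ ∧ Disjoint (w.1 - v.2) X₀)) := by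
    intro v w h
    obtain ⟨⟨-, -, -, hsub⟩, -, hc⟩ := hsupp v w h
    exact ⟨hsub, hc⟩
  have hclique : ∀ c, ∀ v ∈ C c, ∀ w ∈ C c, v ≠ w → B v w = 0 := by
    intro c v hv w hw hvw
    rw [hmem] at hv hw
    obtain ⟨x, hx⟩ := hv.2
    exact entry_eq_zero_of_commonSide X₀ A₀ B hsupp' c x v w hvw hx hv.1 hw.1
  -- a support vertex lies in exactly `s²` of the cliques
  have hY : ∀ v : Finset G × Finset G, B v v ≠ 0 →
      (∑ c, if v ∈ C c then 1 / ((s : ℝ) ^ 2) else 0) = 1 := by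
    intro v hv
    obtain ⟨⟨_, h2, hW, _⟩, -, -⟩ := hsupp v v hv
    obtain ⟨x, hx⟩ := hA v hv
    have hfilter : (Finset.univ.filter fun c => v ∈ C c) =
        Finset.univ.filter fun c : G => ((c +ᵥ A₀) ∩ v.2).Nonempty := by
      refine Finset.filter_congr fun c _ => ?_
      rw [hmem]
      exact ⟨fun h => h.1, fun h => ⟨h, x, hx⟩⟩
    have hA₀ : A₀.card = s := by
      have := congrArg Finset.card hx
      rw [Finset.card_vadd_finset] at this
      omega
    have hW' : ∀ a ∈ x +ᵥ A₀, ∀ a' ∈ x +ᵥ A₀, ∀ b ∈ v.2, ∀ b' ∈ v.2,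
        (a - a') + (b - b') = 0 → a = a' ∧ b = b' := by
      rw [← hx]
      exact hW
    have hcard : (Finset.univ.filter fun c : G => ((c +ᵥ A₀) ∩ v.2).Nonempty).card = s * s := by
      rw [filter_meets_vadd_eq_sub, card_sub_eq_mul_of_direct A₀ v.2 x hW', h2, hA₀]
    rw [Finset.sum_ite, Finset.sum_const_zero, add_zero, Finset.sum_const, nsmul_eq_mul, hfilter, hcard]
    push_cast
    field_simp
  have hcov : ∀ v, B v v ≠ 0 → 1 ≤ ∑ c, if v ∈ C c then 1 / ((s : ℝ) ^ 2) else 0 := by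
    intro v hv
    rw [hY v hv]
  have hmult : ∀ v, B v v ≠ 0 → (∑ c, if v ∈ C c then 1 / ((s : ℝ) ^ 2) else 0) ≤ 1 := by
    intro v hv
    rw [hY v hv]
  -- the fractional clique-cover bound, `Σ B ≤ 1 · (|G|/s²) · tr B`
  have key : ∑ v, ∑ w, B v w ≤ (1 : ℝ) * (∑ _c : G, 1 / ((s : ℝ) ^ 2)) * ∑ v, B v v :=
    CliqueCover.value_le_of_cliqueCover B C (fun _ => 1 / ((s : ℝ) ^ 2)) 1 hsymm hpsd hnn
      (fun _ => by positivity) hclique hcov hmult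
  have e : (1 : ℝ) * (∑ _c : G, 1 / ((s : ℝ) ^ 2)) * ∑ v, B v v =
      (Fintype.card G : ℝ) * (∑ v, B v v) / (s : ℝ) ^ 2 := by
    rw [Finset.sum_const, Finset.card_univ, nsmul_eq_mul]
    ring
  rw [e, le_div_iff₀ hs2] at key
  calc (s : ℝ) ^ 2 * ∑ v, ∑ w, B v w = (∑ v, ∑ w, B v w) * (s : ℝ) ^ 2 := mul_comm _ _
    _ ≤ (Fintype.card G : ℝ) * ∑ v, B v v := key

/-- **Registered milestone stub `stub_thetaCommonSide`** (crux stmt-MatrixMultiplication-14310, line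
fixed-delta-theta-certificate): the common-side clique.  Finite abelian `G`; `B` a symmetric PSD entrywise-nonnegative
kernel on block pairs whose nonzero entries sit on admissible equal-or-compatible pairs (the bet's support
hypothesis verbatim, `G` for `ZMod p`); every vertex of the diagonal support has `A`-side a translate of one fixed
set `A₀`.  Then `s² · Σ_{v,w} B v w ≤ |G| · Σ_v B v v`: a whole common-`A`-side class — arbitrary `B`-sides — obeys the
single-shape wall. -/
theorem stub_thetaCommonSide :
    ∀ (G : Type) [AddCommGroup G] [Fintype G] [DecidableEq G] (s : ℕ) (X₀ A₀ : Finset G)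
      (B : Finset G × Finset G → Finset G × Finset G → ℝ),
      (∀ v w, B v w = B w v) →
      (∀ x : Finset G × Finset G → ℝ, 0 ≤ ∑ v, ∑ w, x v * B v w * x w) →
      (∀ v w, 0 ≤ B v w) →
      (∀ v w : Finset G × Finset G, B v w ≠ 0 →
        (v.1.card = s ∧ v.2.card = s ∧
          (∀ a ∈ v.1, ∀ a' ∈ v.1, ∀ b ∈ v.2, ∀ b' ∈ v.2, (a - a') + (b - b') = 0 → a = a' ∧ b = b') ∧
          v.1 - v.2 ⊆ X₀) ∧
        (w.1.card = s ∧ w.2.card = s ∧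
          (∀ a ∈ w.1, ∀ a' ∈ w.1, ∀ b ∈ w.2, ∀ b' ∈ w.2, (a - a') + (b - b') = 0 → a = a' ∧ b = b') ∧
          w.1 - w.2 ⊆ X₀) ∧
        (v = w ∨ (Disjoint (v.1 - w.2) X₀ ∧ Disjoint (w.1 - v.2) X₀))) →
      (∀ v : Finset G × Finset G, B v v ≠ 0 → ∃ x : G, v.1 = x +ᵥ A₀) →
      (s : ℝ) ^ 2 * ∑ v, ∑ w, B v w ≤ (Fintype.card G : ℝ) * ∑ v, B v v :=
  fun _ _ _ _ s X₀ A₀ B hsymm hpsd hnn hsupp hA =>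
    sq_mul_value_le_of_commonSide s X₀ A₀ B hsymm hpsd hnn hsupp hA

end Summit.MatrixMultiplication.MatrixMultiplication.Theorems.PrimeLogDecayTheta.CommonSide
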